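import Literature.Computability.AlgebraicComplexity.ArithCircuitProofs
import HarnessLib

/-!
# The number of polynomials of bounded circuit complexity over a finite coefficient semiring
# (Forbes 2014, Lemma 3.1.6; Chatterjee–Kumar–Ramya–Saptharishi–Tengse 2020, Claim 3.10)

Topic `Literature/Computability/AlgebraicComplexity`. CKRST 2020 (arXiv v4 Claim 3.10 = [F14,
Lemma 3.1.6]): "Let `𝔽` be a finite field and `n, s ≥ 1`; there are at most `(8 n |𝔽| s²)^s`
`n`-variate polynomials computable by fan-in-2 circuits of size `≤ s`." This file proves the
analogous count in the TREE's circuit model (`ArithCircuit`, `complexity`: fan-in-two gates, a sum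
gate `c₁•u₁ + c₂•u₂` carrying two coefficients, operands = variables / constants / earlier gates,
size = number of gates), where the constant necessarily differs:

* `CircuitCount.exists_finset_complexity_le` — over a finite commutative semiring `k` with `q`
  elements and a finite variable type with `n` elements, **the polynomials `f` with
  `complexity f ≤ s` lie in a finite set of size `≤ (2 q² (n + q + s)²)^s · (n + q + s)`.**

Proof: a syntactic code `(Fin s → GateCode) × OpCode` (`OpCode = σ ⊕ k ⊕ Fin s`: a variable, a
constant, or a reference to one of the `s` gate slots; `GateCode = Bool × k × OpCode × k × OpCode`:
the sum gate `c₁•o₁ + c₂•o₂` or the product gate `o₁ * o₂`) and a decoder onto circuits; every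
fan-in-two circuit of size `≤ s` is the decoding of some code up to its value (arity padded with the
neutral operands `const 0` / `const 1`, junk references `≥ s` replaced by `const 0`, size padded
with trailing dummy gates, the output operand truncated at the size), so
`{f | complexity f ≤ s}` is contained in the image of the code type.

## References

* [ChatterjeeKumarRamyaSaptharishiTengse2020] P. Chatterjee, M. Kumar, C. Ramya, R. Saptharishi,
  A. Tengse, *On the existence of algebraically natural proofs*, arXiv:2004.14147 v4, Claim 3.10
  (v2 ‹Claim 17›; locator paper:arxiv-2004.14147 p0013.txt:L25).
* [Forbes2014] M. A. Forbes, *Polynomial identity testing of read-once oblivious algebraic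
  branching programs*, PhD thesis, MIT 2014, Lemma 3.1.6 (as cited by CKRST; not held).
* [Burgisser2000] P. Bürgisser, *Completeness and Reduction in Algebraic Complexity Theory*,
  Def. 2.1 (the circuit model, `ArithCircuit.lean`).
-/

noncomputable section

namespace Literature.Computability.AlgebraicComplexity

open MvPolynomial ArithCircuit

namespace CircuitCount

universe u v

variable (k : Type u) (σ : Type v) (s : ℕ)

/-- Operand codes for circuits with `s` gate slots: a variable, a constant, or a reference to a
gate slot. [cite: ChatterjeeKumarRamyaSaptharishiTengse2020, Claim 3.10 (arXiv v4), proof ("each gate is described by …")] -/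
abbrev OpCode : Type max u v := σ ⊕ k ⊕ Fin s

/-- Gate codes: `(true, c₁, o₁, c₂, o₂)` is the sum gate `c₁ • o₁ + c₂ • o₂`, `(false, _, o₁, _, o₂)`
the product gate `o₁ * o₂`. [cite: ChatterjeeKumarRamyaSaptharishiTengse2020, Claim 3.10 (arXiv v4), proof] -/
abbrev GateCode : Type max u v := Bool × k × OpCode k σ s × k × OpCode k σ s

/-- Circuit codes: `s` gate codes and an output operand code.
[cite: ChatterjeeKumarRamyaSaptharishiTengse2020, Claim 3.10 (arXiv v4), proof] -/
abbrev Code : Type max u v := (Fin s → GateCode k σ s) × OpCode k σ s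

variable {k σ s}

/-- Decoding an operand code. [cite: ChatterjeeKumarRamyaSaptharishiTengse2020, Claim 3.10 (arXiv v4), proof] -/
def decOp : OpCode k σ s → Operand k σ
  | Sum.inl i => .var i
  | Sum.inr (Sum.inl c) => .const c
  | Sum.inr (Sum.inr j) => .gate j

/-- Decoding a gate code. [cite: ChatterjeeKumarRamyaSaptharishiTengse2020, Claim 3.10 (arXiv v4), proof] -/
def decGate : GateCode k σ s → Gate k σ
  | (true, c₁, o₁, c₂, o₂) => .sum [(c₁, decOp o₁), (c₂, decOp o₂)]
  | (false, _, o₁, _, o₂) => .prod [decOp o₁, decOp o₂]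

/-- Decoding a circuit code: the `s` decoded gates in order, and the decoded output operand.
[cite: ChatterjeeKumarRamyaSaptharishiTengse2020, Claim 3.10 (arXiv v4), proof] -/
def decode (c : Code k σ s) : ArithCircuit k σ :=
  ⟨(List.ofFn c.1).map decGate, decOp c.2⟩

section Encode

variable [Zero k]

/-- Encoding an operand (a junk gate reference `≥ s` becomes the constant `0`).
[cite: ChatterjeeKumarRamyaSaptharishiTengse2020, Claim 3.10 (arXiv v4), proof] -/
def encOp : Operand k σ → OpCode k σ s
  | .var i => Sum.inl i
  | .const c => Sum.inr (Sum.inl c)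
  | .gate j => if h : j < s then Sum.inr (Sum.inr ⟨j, h⟩) else Sum.inr (Sum.inl 0)

/-- Decoding an encoded operand truncates it at `s`. [cite: ChatterjeeKumarRamyaSaptharishiTengse2020, Claim 3.10 (arXiv v4), proof] -/
theorem decOp_encOp (u : Operand k σ) : decOp (encOp u : OpCode k σ s) = u.truncate s := by
  cases u with
  | var i => rfl
  | const c => rfl
  | gate j =>
    by_cases h : j < s
    · simp [encOp, decOp, Operand.truncate, h]
    · simp [encOp, decOp, Operand.truncate, h]

variable [One k]

/-- Encoding a gate of fan-in `≤ 2`: missing operands of a sum gate are padded with `0 • const 0`,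
of a product gate with `const 1`. [cite: ChatterjeeKumarRamyaSaptharishiTengse2020, Claim 3.10 (arXiv v4), proof] -/
def encGate : Gate k σ → GateCode k σ s
  | .sum args =>
      (true, (args.getD 0 (0, .const 0)).1, encOp (args.getD 0 (0, .const 0)).2,
        (args.getD 1 (0, .const 0)).1, encOp (args.getD 1 (0, .const 0)).2)
  | .prod args => (false, 0, encOp (args.getD 0 (.const 1)), 0, encOp (args.getD 1 (.const 1)))

end Encode

section Semantics

variable [CommSemiring k]

/-- Truncating at or beyond the length of the value list does not change the value of an operand
(junk references and `const 0` both evaluate to `0`). [cite: Burgisser2000, Def. 2.1] -/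
theorem eval_truncate_of_le (vals : List (MvPolynomial σ k)) (u : Operand k σ) {m : ℕ}
    (hm : vals.length ≤ m) : (u.truncate m).eval vals = u.eval vals := by
  cases u with
  | var i => rfl
  | const c => rfl
  | gate j =>
    by_cases h : j < m
    · simp [Operand.truncate, h]
    · have hj : vals.length ≤ j := le_trans hm (not_lt.1 h)
      simp [Operand.truncate, h, Operand.eval, List.getD_eq_getElem?_getD,
        List.getElem?_eq_none hj]

/-- Double truncation: truncating at `a ≤ b` and then at `b` is truncating at `a`. [cite: Burgisser2000, Def. 2.1] -/
theorem truncate_truncate_of_le (u : Operand k σ) {a b : ℕ} (hab : a ≤ b) :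
    (u.truncate a).truncate b = u.truncate a := by
  cases u with
  | var i => rfl
  | const c => rfl
  | gate j =>
    by_cases h : j < a
    · have hb : j < b := lt_of_lt_of_le h hab
      simp [Operand.truncate, h, hb]
    · simp [Operand.truncate, h]

/-- A fan-in-two gate and the decoding of its code have the same value against any value list of
length `≤ s`. [cite: ChatterjeeKumarRamyaSaptharishiTengse2020, Claim 3.10 (arXiv v4), proof] -/
theorem eval_decGate_encGate (vals : List (MvPolynomial σ k)) (hlen : vals.length ≤ s)
    (g : Gate k σ) (hg : g.fanIn ≤ 2) :
    (decGate (encGate g : GateCode k σ s)).eval vals = g.eval vals := by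
  cases g with
  | sum args =>
    rcases args with _ | ⟨a, _ | ⟨b, _ | ⟨c, rest⟩⟩⟩
    · simp only [encGate, decGate, List.getD_nil, decOp_encOp, Gate.eval, List.map_cons,
        List.map_nil, List.sum_cons, List.sum_nil, eval_truncate_of_le vals _ hlen]
      simp [Operand.eval]
    · simp only [encGate, decGate, List.getD_cons_zero, List.getD_cons_succ, List.getD_nil,
        decOp_encOp, Gate.eval, List.map_cons, List.map_nil, List.sum_cons, List.sum_nil,
        eval_truncate_of_le vals _ hlen]
      simp [Operand.eval]
    · simp only [encGate, decGate, List.getD_cons_zero, List.getD_cons_succ, decOp_encOp,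
        Gate.eval, List.map_cons, List.map_nil, List.sum_cons, List.sum_nil,
        eval_truncate_of_le vals _ hlen]
    · simp [Gate.fanIn, Gate.args] at hg
  | prod args =>
    rcases args with _ | ⟨a, _ | ⟨b, _ | ⟨c, rest⟩⟩⟩
    · simp only [encGate, decGate, List.getD_nil, decOp_encOp, Gate.eval, List.map_cons,
        List.map_nil, List.prod_cons, List.prod_nil, eval_truncate_of_le vals _ hlen]
      simp [Operand.eval]
    · simp only [encGate, decGate, List.getD_cons_zero, List.getD_cons_succ, List.getD_nil,
        decOp_encOp, Gate.eval, List.map_cons, List.map_nil, List.prod_cons, List.prod_nil,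
        eval_truncate_of_le vals _ hlen]
      simp [Operand.eval]
    · simp only [encGate, decGate, List.getD_cons_zero, List.getD_cons_succ, decOp_encOp,
        Gate.eval, List.map_cons, List.map_nil, List.prod_cons, List.prod_nil,
        eval_truncate_of_le vals _ hlen]
    · simp [Gate.fanIn, Gate.args] at hg

/-- Re-coding every gate of a fan-in-two gate list of length `≤ s` does not change the value list.
[cite: ChatterjeeKumarRamyaSaptharishiTengse2020, Claim 3.10 (arXiv v4), proof] -/
theorem gateValues_map_recode (gs : List (Gate k σ)) (hs : gs.length ≤ s)
    (h2 : ∀ g ∈ gs, g.fanIn ≤ 2) :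
    gateValues (gs.map fun g => decGate (encGate g : GateCode k σ s)) = gateValues gs := by
  induction gs using List.reverseRecOn with
  | nil => rfl
  | append_singleton gs g ih =>
    rw [List.length_append, List.length_singleton] at hs
    rw [List.map_append, List.map_singleton, gateValues_append_singleton,
      gateValues_append_singleton, ih (by omega) (fun g' hg' => h2 g' (List.mem_append_left _ hg')),
      eval_decGate_encGate _ (by rw [gateValues_length]; omega) g
        (h2 g (List.mem_append_right _ (List.mem_singleton_self g)))]

/-- Appending gates extends the value list. [cite: Burgisser2000, Def. 2.1 / proof of Prop. 2.3] -/
theorem exists_gateValues_append (gs ex : List (Gate k σ)) :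
    ∃ ws, gateValues (gs ++ ex) = gateValues gs ++ ws := by
  induction ex using List.reverseRecOn with
  | nil => exact ⟨[], by simp⟩
  | append_singleton ex g ih =>
    obtain ⟨ws, hws⟩ := ih
    refine ⟨ws ++ [g.eval (gateValues (gs ++ ex))], ?_⟩
    rw [← List.append_assoc, gateValues_append_singleton, hws, List.append_assoc]

/-- **Every fan-in-two circuit with at most `s` gates is, up to its value, the decoding of a
code.** [cite: ChatterjeeKumarRamyaSaptharishiTengse2020, Claim 3.10 (arXiv v4), proof] -/
theorem exists_code_eval_eq (P : ArithCircuit k σ) (h2 : P.IsFanInTwo) (hs : P.size ≤ s) :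
    ∃ c : Code k σ s, (decode c).eval = P.eval := by
  classical
  set len := P.gates.length with hlen
  have hlen' : len ≤ s := hs
  -- the code: encoded gates, then dummy gates; the output truncated at the size
  let dummy : GateCode k σ s := encGate (Gate.prod [])
  let cg : Fin s → GateCode k σ s := fun i =>
    if h : (i : ℕ) < len then encGate (P.gates[(i : ℕ)]'h) else dummy
  refine ⟨(cg, encOp (P.output.truncate len)), ?_⟩
  -- the decoded gate list = re-coded gates ++ dummies
  have hlist : List.ofFn cg = P.gates.map (fun g => (encGate g : GateCode k σ s)) ++
      List.replicate (s - len) dummy := by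
    apply List.ext_getElem
    · simp only [List.length_ofFn, List.length_append, List.length_map, List.length_replicate]
      omega
    · intro i h₁ h₂
      rw [List.getElem_ofFn]
      by_cases hi : i < len
      · rw [List.getElem_append_left (by rw [List.length_map]; exact hi), List.getElem_map]
        simp [cg, hi]
      · rw [List.getElem_append_right (by rw [List.length_map]; exact not_lt.1 hi),
          List.getElem_replicate]
        simp [cg, hi]
  obtain ⟨ws, hws⟩ := exists_gateValues_append
    (P.gates.map fun g => decGate (encGate g : GateCode k σ s))
    ((List.replicate (s - len) dummy).map decGate)
  have hvals : gateValues (P.gates.map fun g => decGate (encGate g : GateCode k σ s)) =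
      gateValues P.gates :=
    gateValues_map_recode P.gates hlen' h2
  have hL : (gateValues P.gates).length = len := gateValues_length _
  show (decOp (encOp (P.output.truncate len) : OpCode k σ s)).eval
      (gateValues ((List.ofFn cg).map decGate)) = P.output.eval (gateValues P.gates)
  rw [hlist, List.map_append, List.map_map, Function.comp_def, hws, hvals, decOp_encOp,
    truncate_truncate_of_le _ hlen', ← hL, Operand.eval_truncate_append]

end Semantics

section Count

variable (k : Type u) (σ : Type v) [CommSemiring k] [Fintype k] [DecidableEq k] [Fintype σ]
  [DecidableEq σ] (s : ℕ)

/-- **[F14, Lemma 3.1.6] = CKRST 2020, Claim 3.10, in the tree's circuit model.** Over a finite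
commutative semiring `k` with `q` elements and `n = #σ` variables, the polynomials of fan-in-two
circuit complexity `≤ s` lie in a finite set of at most `(2 q² (n + q + s)²)^s · (n + q + s)`
polynomials (printed, for the gate-count model of [F14]: "at most `(8 n |𝔽| s²)^s`"; the tree's
sum gates carry two coefficients from `k`, whence the factor `q²` per gate).
[cite: ChatterjeeKumarRamyaSaptharishiTengse2020, Claim 3.10 (arXiv v4) = [F14, Lemma 3.1.6]] -/
theorem exists_finset_complexity_le :
    ∃ 𝒞 : Finset (MvPolynomial σ k),
      𝒞.card ≤ (2 * Fintype.card k ^ 2 * (Fintype.card σ + Fintype.card k + s) ^ 2) ^ s *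
          (Fintype.card σ + Fintype.card k + s) ∧
        ∀ f : MvPolynomial σ k, complexity f ≤ s → f ∈ 𝒞 := by
  classical
  refine ⟨(Finset.univ : Finset (Code k σ s)).image fun c => (decode c).eval, ?_, ?_⟩
  · refine Finset.card_image_le.trans (le_of_eq ?_)
    simp only [Finset.card_univ, Fintype.card_prod, Fintype.card_fun, Fintype.card_sum,
      Fintype.card_bool, Fintype.card_fin]
    ring
  · intro f hf
    obtain ⟨P, hP2, hPf, hsize⟩ := ArithCircuit.exists_computes_size_eq_complexity f
    obtain ⟨c, hc⟩ := exists_code_eval_eq P hP2 (hsize ▸ hf)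
    exact Finset.mem_image.2 ⟨c, Finset.mem_univ _, hc.trans hPf⟩

end Count

end CircuitCount

end Literature.Computability.AlgebraicComplexity
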